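import Summits.CriticalPhenomena.SAWScalingLimit.Theorems.SAWTotalPositivityBoundaryTP2Kernel
import Summits.CriticalPhenomena.SAWScalingLimit.Theorems.SAWTotalPositivityBoundaryTP2Symmetry
import Summits.CriticalPhenomena.SAWScalingLimit.Theorems.SAWTotalPositivityBoundaryTP2CutVertex
import Literature.Combinatorics.SimpleGraph.MengerTwo
import HarnessLib

/-!
# `InterlacedTP2At x ⟸ GraphTP2At x ∧ (three-point splitting)`: the interlacing-only core decomposed

Crux `LeftRightFKG` (stmt-CriticalPhenomena-11232), line `corner-localisation`, lead c2
(prover-line-stmt-CriticalPhenomena-11232-c2-0, 2026-08-16). After leads 0/c1 the crux is a kernel-checked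
consequence of ONE named open statement, `BoundaryTP2.InterlacedTP2At x_c` (interlacing-only TP₂ of the
critical self-avoiding path kernel `Z_H = BoundaryTP2.pathKernel H x` on finite subgraphs `H ≤ ℤ²`,
`…Theorems/SAWLeftRightFKGLeftRightFKGOfInterlacedTP2.lean`). The sibling crux `SAWTotalPositivity.BoundaryTP2`
(stmt-CriticalPhenomena-7115) is reduced to the WEAKER core `BoundaryTP2.GraphTP2At x_c` (the same inequality for
interlaced quadruples that are moreover disjointly realisable in both nested pairings). This file proves that the
gap between the two cores is exactly a THREE-POINT SPLITTING INEQUALITY: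

* `interlacedTP2At_of_graphTP2At` : for `0 ≤ x`,
  `GraphTP2At x → (∀ H ≤ ℤ², finite support, ∀ w ∼ w' with w' isolated in H, ∀ p q, w,p,q pairwise distinct →
     Z_H(w,p) · Z_H(w,q) ≤ Z_H(p,q)) → InterlacedTP2At x`.

The second hypothesis is written out (it is named `ThreePointAt x` in the line's vocabulary file; the converse
`InterlacedTP2At x → ThreePointAt x` is the one-pendant trick, cf. `BoundaryTP2.stub_pendant_threePoint`).

PROOF. Let `(p₁,p₂,p₃,p₄)` be pairwise distinct and interlaced (every path `p₁ → p₃` meets every path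
`p₂ → p₄`). If both nested pairings `(p₁p₂|p₃p₄)`, `(p₁p₄|p₂p₃)` are realisable by vertex-disjoint paths, this
is a `GraphTP2At` instance. If `(p₁p₄|p₂p₃)` is not, then no two vertex-disjoint paths join `S = {p₁,p₂}` to
`T = {p₃,p₄}` (the pairing `p₁→p₃, p₂→p₄` is excluded by interlacing, `p₁→p₄, p₂→p₃` by assumption), so by
MENGER'S THEOREM FOR TWO PATHS (`Literature.Combinatorics.SimpleGraph.exists_mem_support_forall`) one vertex `z`
lies on every `S`–`T` walk (unless there is none, when `Z(p₁,p₃) = 0`). Splitting `H` at `z` into the piece `A`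
(everything not reaching `T` off `z`) and the piece `B` (everything reaching `T` off `z`), the cut-vertex
factorisation `BoundaryTP2.stub_cutVertex_factor` gives `Z(pᵢ,pⱼ) = Z_A(pᵢ,z) Z_B(z,pⱼ)` (`i ∈ {1,2}`,
`j ∈ {3,4}`), so `Z₁₃Z₂₄ = [Z_A(p₁,z)Z_A(p₂,z)]·[Z_B(z,p₃)Z_B(z,p₄)]`, while `Z₁₂Z₃₄ ≥ Z_A(p₁,p₂)·Z_B(p₃,p₄)`
(monotonicity of the kernel in the graph). Each bracket is at most the corresponding factor: with equality when
`z` is one of the two points (`Z(z,z) = 1`), and by the three-point inequality in the piece otherwise — the free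
lattice neighbour of `z` required there is its first step towards the OTHER piece (which exists as soon as the
other bracket is non-zero). If instead `(p₁p₂|p₃p₄)` is not realisable, Menger for `S = {p₁,p₄}`, `T = {p₂,p₃}`
gives a cut vertex `z` and the factorisation shows `Z₁₃Z₂₄ = Z₁₂Z₃₄` outright. Everything here is proved;
Mathlib, the sibling toolkit (`Defs`, `Kernel`, `Symmetry`, `CutVertex`) and `MengerTwo` only. [folklore]
-/

noncomputable section

open Literature.Probability.LatticeModels
open scoped Classical ENNReal

namespace Summit.CriticalPhenomena.SAWScalingLimit.Theorems.LeftRightFKG.ThreePoint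

open Summit.CriticalPhenomena.SAWScalingLimit.Theorems.BoundaryTP2

variable {V : Type*}

/-! ## The two pieces at a one-vertex cut between vertex sets -/

/-- Adjacency in the piece of `H` on a vertex set `S` (a graph on all of `V`, built with `SimpleGraph.fromRel`):
`u ∼ v` iff `u ∼_H v` and both lie in `S`. [folklore] -/
theorem adj_piece (H : SimpleGraph V) (S : Set V) (u v : V) :
    (SimpleGraph.fromRel fun u v => H.Adj u v ∧ u ∈ S ∧ v ∈ S).Adj u v ↔ H.Adj u v ∧ u ∈ S ∧ v ∈ S := by
  rw [SimpleGraph.fromRel_adj]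
  constructor
  · rintro ⟨-, ⟨h, hu, hv⟩ | ⟨h, hv, hu⟩⟩
    · exact ⟨h, hu, hv⟩
    · exact ⟨h.symm, hu, hv⟩
  · rintro ⟨h, hu, hv⟩
    exact ⟨h.ne, Or.inl ⟨h, hu, hv⟩⟩

/-- The piece of `H` on `S` is a subgraph of `H`. [folklore] -/
theorem piece_le (H : SimpleGraph V) (S : Set V) :
    (SimpleGraph.fromRel fun u v => H.Adj u v ∧ u ∈ S ∧ v ∈ S) ≤ H :=
  fun u v h => ((adj_piece H S u v).1 h).1

/-- THE CUT DATA. If the vertex `z` lies on every walk from `S` to `T`, then `B = {z} ∪ {v | v reaches T by a walk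
avoiding z}` and `A = {z} ∪ Bᶜ` cover `V`, meet exactly in `z`, every edge of `H` lies inside `A` or inside `B`,
`S ⊆ A` and `T ⊆ B` (the hypotheses of the cut-vertex factorisation `BoundaryTP2.stub_cutVertex_factor`). [folklore] -/
theorem exists_cut_sets (H : SimpleGraph V) (S T : Set V) (z : V)
    (hz : ∀ (s t : V) (q : H.Walk s t), s ∈ S → t ∈ T → z ∈ q.support) :
    ∃ A B : Set V, (∀ v, v ∈ A ∨ v ∈ B) ∧ (∀ v, v ∈ A → v ∈ B → v = z) ∧ z ∈ A ∧ z ∈ B ∧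
      (∀ u v, H.Adj u v → (u ∈ A ∧ v ∈ A) ∨ (u ∈ B ∧ v ∈ B)) ∧ (∀ s, s ∈ S → s ∈ A) ∧
      (∀ t, t ∈ T → t ∈ B) := by
  obtain ⟨B, hB⟩ : ∃ B : Set V, B = {v | v = z ∨ ∃ t ∈ T, ∃ q : H.Walk v t, z ∉ q.support} :=
    ⟨_, rfl⟩
  obtain ⟨A, hA⟩ : ∃ A : Set V, A = {v | v = z ∨ v ∉ B} := ⟨_, rfl⟩
  have hzA : z ∈ A := by rw [hA, Set.mem_setOf_eq]; exact Or.inl rfl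
  have hzB : z ∈ B := by rw [hB, Set.mem_setOf_eq]; exact Or.inl rfl
  have hnA : ∀ v, v ∉ B → v ∈ A := fun v hv => by rw [hA, Set.mem_setOf_eq]; exact Or.inr hv
  refine ⟨A, B, fun v => ?_, fun v hvA hvB => ?_, hzA, hzB, fun a b hab => ?_, fun s hs => ?_, fun t ht => ?_⟩
  · by_cases h : v ∈ B
    · exact Or.inr h
    · exact Or.inl (hnA v h)
  · rw [hA, Set.mem_setOf_eq] at hvA
    exact hvA.elim id fun h => absurd hvB h
  · -- reaching `T` off `z` propagates along edges not at `z`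
    have hprop : ∀ a b, H.Adj a b → a ∈ B → a ≠ z → b ∈ B := fun a b hab haB haz => by
      rw [hB, Set.mem_setOf_eq] at haB ⊢
      by_cases hbz : b = z
      · exact Or.inl hbz
      · obtain ⟨t, ht, q, hq⟩ := haB.resolve_left haz
        refine Or.inr ⟨t, ht, SimpleGraph.Walk.cons hab.symm q, ?_⟩
        rw [SimpleGraph.Walk.support_cons, List.mem_cons]
        rintro (h | h)
        · exact hbz h.symm
        · exact hq h
    by_cases haB : a ∈ B <;> by_cases hbB : b ∈ B
    · exact Or.inr ⟨haB, hbB⟩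
    · have haz : a = z := by
        by_contra haz
        exact hbB (hprop a b hab haB haz)
      exact Or.inl ⟨by rw [haz]; exact hzA, hnA b hbB⟩
    · have hbz : b = z := by
        by_contra hbz
        exact haB (hprop b a hab.symm hbB hbz)
      exact Or.inl ⟨hnA a haB, by rw [hbz]; exact hzA⟩
    · exact Or.inl ⟨hnA a haB, hnA b hbB⟩
  · by_cases hsz : s = z
    · rw [hsz]; exact hzA
    · refine hnA s fun hsB => ?_
      rw [hB, Set.mem_setOf_eq] at hsB
      rcases hsB with h | ⟨t, ht, q, hq⟩
      · exact hsz h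
      · exact hq (hz s t q hs ht)
  · rw [hB, Set.mem_setOf_eq]
    by_cases htz : t = z
    · exact Or.inl htz
    · refine Or.inr ⟨t, ht, SimpleGraph.Walk.nil, ?_⟩
      rw [SimpleGraph.Walk.support_nil, List.mem_singleton]
      exact fun h => htz h.symm

/-- A non-zero kernel entry between distinct vertices gives a first step: some neighbour of `a`. [folklore] -/
theorem exists_adj_of_pathKernel_ne_zero (H : SimpleGraph V) (x : ℝ) {a b : V} (hab : a ≠ b)
    (h : pathKernel H x a b ≠ 0) : ∃ u, H.Adj a u := by
  by_contra hno
  refine h (pathKernel_eq_zero_of_not_reachable H x fun hr => ?_)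
  obtain ⟨p⟩ := hr
  exact hno (exists_adj_of_walk_ne p hab)

/-- A vertex all of whose `H`-edges are absent is outside the support. If `u ∼ v` in the piece on `B`, where `A`
and `B` meet only in `z` and `u = z`, then `v` is isolated in the piece on `A`. [folklore] -/
theorem not_mem_support_piece {H : SimpleGraph V} {A B : Set V} {z v : V}
    (hc : ∀ w, w ∈ A → w ∈ B → w = z)
    (hv : (SimpleGraph.fromRel fun u v => H.Adj u v ∧ u ∈ B ∧ v ∈ B).Adj z v) :
    v ∉ (SimpleGraph.fromRel fun u v => H.Adj u v ∧ u ∈ A ∧ v ∈ A).support := by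
  obtain ⟨hzv, -, hvB⟩ := (adj_piece H B z v).1 hv
  rintro ⟨w, hw⟩
  obtain ⟨-, hvA, -⟩ := (adj_piece H A v w).1 hw
  exact hzv.ne (hc v hvA hvB).symm

/-! ## The three-point bracket at the cut vertex -/

/-- THE BRACKET INEQUALITY. In a finite piece `G ≤ ℤ²`, for distinct `p, q` and a vertex `z` that either is one
of them or has a lattice neighbour isolated in `G`, the three-point hypothesis gives
`Z_G(p,z) · Z_G(q,z) ≤ Z_G(p,q)` (equality via `Z(z,z) = 1` in the coincident cases). [folklore] -/
theorem bracket_le (x : ℝ)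
    (h₃ : ∀ H : SimpleGraph (Site 2), H ≤ zdGraph 2 → H.support.Finite →
      ∀ w w' p q : Site 2, (zdGraph 2).Adj w w' → w' ∉ H.support → w ≠ p → w ≠ q → p ≠ q →
        pathKernel H x w p * pathKernel H x w q ≤ pathKernel H x p q)
    (G : SimpleGraph (Site 2)) (hG : G ≤ zdGraph 2) (hfin : G.support.Finite) (p q z : Site 2) (hpq : p ≠ q)
    (hz : z = p ∨ z = q ∨ ∃ w', (zdGraph 2).Adj z w' ∧ w' ∉ G.support) :
    pathKernel G x p z * pathKernel G x q z ≤ pathKernel G x p q := by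
  rcases hz with rfl | rfl | ⟨w', hzw', hw'⟩
  · rw [pathKernel_self, one_mul, pathKernel_comm]
  · rw [pathKernel_self, mul_one]
  · by_cases hzp : z = p
    · subst hzp; rw [pathKernel_self, one_mul, pathKernel_comm]
    by_cases hzq : z = q
    · subst hzq; rw [pathKernel_self, mul_one]
    rw [pathKernel_comm G x p z, pathKernel_comm G x q z]
    exact h₃ G hG hfin z w' p q hzw' hw' hzp hzq hpq

/-! ## The decomposition -/

/-- **`GraphTP2At x` and the three-point splitting inequality imply `InterlacedTP2At x`** (`0 ≤ x`). For a
pairwise distinct interlaced quadruple: if both nested pairings are disjointly realisable it is a `GraphTP2At`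
instance; otherwise Menger's theorem for two paths gives a one-vertex cut `z` between `{p₁,p₂}` and `{p₃,p₄}`
(resp. `{p₁,p₄}` and `{p₂,p₃}`), the kernel factorises through `z` (`BoundaryTP2.stub_cutVertex_factor`), and
the TP₂ inequality becomes the product of two three-point brackets on the two pieces (resp. an equality).
[folklore] -/
theorem interlacedTP2At_of_graphTP2At {x : ℝ} (hx : 0 ≤ x) (h₁ : GraphTP2At x)
    (h₃ : ∀ H : SimpleGraph (Site 2), H ≤ zdGraph 2 → H.support.Finite →
      ∀ w w' p q : Site 2, (zdGraph 2).Adj w w' → w' ∉ H.support → w ≠ p → w ≠ q → p ≠ q →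
        pathKernel H x w p * pathKernel H x w q ≤ pathKernel H x p q) :
    InterlacedTP2At x := by
  intro H hH hfin p₁ p₂ p₃ p₄ h12 h13 h14 h23 h24 h34 hI
  -- trivial when `p₁` does not reach `p₃`
  by_cases hreach : H.Reachable p₁ p₃
  swap
  · rw [pathKernel_eq_zero_of_not_reachable H x hreach, zero_mul]; exact zero_le
  by_cases hiii : DisjointPaths H p₁ p₄ p₂ p₃
  · by_cases hii : DisjointPaths H p₁ p₂ p₃ p₄
    · exact h₁ H hH hfin p₁ p₂ p₃ p₄ hI hii hiii
    · -- `(p₁p₂|p₃p₄)` not realisable: cut vertex between `{p₁,p₄}` and `{p₂,p₃}`, equality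
      obtain ⟨z, -, hz⟩ := Literature.Combinatorics.SimpleGraph.exists_mem_support_forall
        (G := H) (A := Set.univ) (S := {s | s = p₁ ∨ s = p₄}) (T := {t | t = p₂ ∨ t = p₃})
        (by
          obtain ⟨q⟩ := hreach
          exact ⟨p₁, p₃, q, Or.inl rfl, Or.inr rfl, fun y _ => Set.mem_univ y⟩)
        (by
          rintro ⟨s₁, t₁, s₂, t₂, q₁, q₂, hs₁, ht₁, hs₂, ht₂, hq₁, hq₂, -, -, hdisj⟩
          have hs : s₁ ≠ s₂ := by
            rintro rfl; exact hdisj s₁ q₁.start_mem_support q₂.start_mem_support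
          have ht : t₁ ≠ t₂ := by
            rintro rfl; exact hdisj t₁ q₁.end_mem_support q₂.end_mem_support
          rw [Set.mem_setOf_eq] at hs₁ hs₂ ht₁ ht₂
          rcases hs₁ with rfl | rfl <;> rcases hs₂ with rfl | rfl
          · exact hs rfl
          · rcases ht₁ with rfl | rfl <;> rcases ht₂ with rfl | rfl
            · exact ht rfl
            · -- `q₁ : p₁ → p₂`, `q₂ : p₄ → p₃`
              exact hii ⟨⟨q₁, hq₁⟩, ⟨q₂.reverse, hq₂.reverse⟩, by
                intro y hy hy'
                exact hdisj y hy (by rw [SimpleGraph.Walk.support_reverse, List.mem_reverse] at hy'; exact hy')⟩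
            · -- `q₁ : p₁ → p₃`, `q₂ : p₄ → p₂`
              obtain ⟨v, hv₁, hv₂⟩ := hI ⟨q₁, hq₁⟩ ⟨q₂.reverse, hq₂.reverse⟩
              exact hdisj v hv₁ (by
                rw [SimpleGraph.Walk.support_reverse, List.mem_reverse] at hv₂; exact hv₂)
            · exact ht rfl
          · rcases ht₁ with rfl | rfl <;> rcases ht₂ with rfl | rfl
            · exact ht rfl
            · -- `q₁ : p₄ → p₂`, `q₂ : p₁ → p₃`
              obtain ⟨v, hv₁, hv₂⟩ := hI ⟨q₂, hq₂⟩ ⟨q₁.reverse, hq₁.reverse⟩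
              exact hdisj v (by
                rw [SimpleGraph.Walk.support_reverse, List.mem_reverse] at hv₂; exact hv₂) hv₁
            · -- `q₁ : p₄ → p₃`, `q₂ : p₁ → p₂`
              exact hii ⟨⟨q₂, hq₂⟩, ⟨q₁.reverse, hq₁.reverse⟩, by
                intro y hy hy'
                exact hdisj y (by rw [SimpleGraph.Walk.support_reverse, List.mem_reverse] at hy'; exact hy') hy⟩
            · exact ht rfl
          · exact hs rfl)
      replace hz : ∀ (s t : Site 2) (q : H.Walk s t), s ∈ ({s | s = p₁ ∨ s = p₄} : Set (Site 2)) →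
          t ∈ ({t | t = p₂ ∨ t = p₃} : Set (Site 2)) → z ∈ q.support :=
        fun s t q hs ht => hz s t q hs ht fun y _ => Set.mem_univ y
      obtain ⟨A, B, hAB, hc, hzA, hzB, hsep, hS, hT⟩ := exists_cut_sets H _ _ z hz
      have hf := fun s t (hs : s = p₁ ∨ s = p₄) (ht : t = p₂ ∨ t = p₃) =>
        stub_cutVertex_factor H x hx A B z s t hAB hc hzA hzB hsep (hS s hs) (hT t ht)
      rw [hf p₁ p₃ (Or.inl rfl) (Or.inr rfl), pathKernel_comm H x p₂ p₄, hf p₄ p₂ (Or.inr rfl) (Or.inl rfl),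
        hf p₁ p₂ (Or.inl rfl) (Or.inl rfl), pathKernel_comm H x p₃ p₄, hf p₄ p₃ (Or.inr rfl) (Or.inr rfl)]
      exact le_of_eq (by ring)
  · -- `(p₁p₄|p₂p₃)` not realisable: cut vertex between `{p₁,p₂}` and `{p₃,p₄}`, two brackets
    obtain ⟨z, -, hz⟩ := Literature.Combinatorics.SimpleGraph.exists_mem_support_forall
      (G := H) (A := Set.univ) (S := {s | s = p₁ ∨ s = p₂}) (T := {t | t = p₃ ∨ t = p₄})
      (by
        obtain ⟨q⟩ := hreach
        exact ⟨p₁, p₃, q, Or.inl rfl, Or.inl rfl, fun y _ => Set.mem_univ y⟩)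
      (by
        rintro ⟨s₁, t₁, s₂, t₂, q₁, q₂, hs₁, ht₁, hs₂, ht₂, hq₁, hq₂, -, -, hdisj⟩
        have hs : s₁ ≠ s₂ := by
          rintro rfl; exact hdisj s₁ q₁.start_mem_support q₂.start_mem_support
        have ht : t₁ ≠ t₂ := by
          rintro rfl; exact hdisj t₁ q₁.end_mem_support q₂.end_mem_support
        rw [Set.mem_setOf_eq] at hs₁ hs₂ ht₁ ht₂
        rcases hs₁ with rfl | rfl <;> rcases hs₂ with rfl | rfl
        · exact hs rfl
        · rcases ht₁ with rfl | rfl <;> rcases ht₂ with rfl | rfl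
          · exact ht rfl
          · -- `q₁ : p₁ → p₃`, `q₂ : p₂ → p₄`: interlacing
            obtain ⟨v, hv₁, hv₂⟩ := hI ⟨q₁, hq₁⟩ ⟨q₂, hq₂⟩
            exact hdisj v hv₁ hv₂
          · -- `q₁ : p₁ → p₄`, `q₂ : p₂ → p₃`
            exact hiii ⟨⟨q₁, hq₁⟩, ⟨q₂, hq₂⟩, by intro y hy hy'; exact hdisj y hy hy'⟩
          · exact ht rfl
        · rcases ht₁ with rfl | rfl <;> rcases ht₂ with rfl | rfl
          · exact ht rfl
          · -- `q₁ : p₂ → p₃`, `q₂ : p₁ → p₄`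
            exact hiii ⟨⟨q₂, hq₂⟩, ⟨q₁, hq₁⟩, by intro y hy hy'; exact hdisj y hy' hy⟩
          · -- `q₁ : p₂ → p₄`, `q₂ : p₁ → p₃`: interlacing
            obtain ⟨v, hv₁, hv₂⟩ := hI ⟨q₂, hq₂⟩ ⟨q₁, hq₁⟩
            exact hdisj v hv₂ hv₁
          · exact ht rfl
        · exact hs rfl)
    replace hz : ∀ (s t : Site 2) (q : H.Walk s t), s ∈ ({s | s = p₁ ∨ s = p₂} : Set (Site 2)) →
        t ∈ ({t | t = p₃ ∨ t = p₄} : Set (Site 2)) → z ∈ q.support :=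
      fun s t q hs ht => hz s t q hs ht fun y _ => Set.mem_univ y
    obtain ⟨A, B, hAB, hc, hzA, hzB, hsep, hS, hT⟩ := exists_cut_sets H _ _ z hz
    set GA := SimpleGraph.fromRel fun u v => H.Adj u v ∧ u ∈ A ∧ v ∈ A with hGA
    set GB := SimpleGraph.fromRel fun u v => H.Adj u v ∧ u ∈ B ∧ v ∈ B with hGB
    have hAle : GA ≤ H := piece_le H A
    have hBle : GB ≤ H := piece_le H B
    have hAfin : GA.support.Finite := hfin.subset (SimpleGraph.support_mono hAle)
    have hBfin : GB.support.Finite := hfin.subset (SimpleGraph.support_mono hBle)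
    have hf := fun s t (hs : s = p₁ ∨ s = p₂) (ht : t = p₃ ∨ t = p₄) =>
      stub_cutVertex_factor H x hx A B z s t hAB hc hzA hzB hsep (hS s hs) (hT t ht)
    -- the factorised left-hand side
    have hL : pathKernel H x p₁ p₃ * pathKernel H x p₂ p₄ =
        (pathKernel GA x p₁ z * pathKernel GA x p₂ z) * (pathKernel GB x z p₃ * pathKernel GB x z p₄) := by
      rw [hf p₁ p₃ (Or.inl rfl) (Or.inl rfl), hf p₂ p₄ (Or.inr rfl) (Or.inr rfl)]; ring
    rw [hL]
    -- vanishing brackets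
    by_cases hA0 : pathKernel GA x p₁ z * pathKernel GA x p₂ z = 0
    · rw [hA0, zero_mul]; exact zero_le
    by_cases hB0 : pathKernel GB x z p₃ * pathKernel GB x z p₄ = 0
    · rw [hB0, mul_zero]; exact zero_le
    obtain ⟨hA1, hA2⟩ := mul_ne_zero_iff.1 hA0
    obtain ⟨hB3, hB4⟩ := mul_ne_zero_iff.1 hB0
    -- a free neighbour of `z` in the `A`-piece: its first step towards `T` in the `B`-piece
    have hzA' : z = p₁ ∨ z = p₂ ∨ ∃ w', (zdGraph 2).Adj z w' ∧ w' ∉ GA.support := by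
      by_cases hz1 : z = p₁
      · exact Or.inl hz1
      by_cases hz2 : z = p₂
      · exact Or.inr (Or.inl hz2)
      refine Or.inr (Or.inr ?_)
      by_cases hz3 : z = p₃
      · have hz4 : z ≠ p₄ := hz3 ▸ h34
        obtain ⟨w', hw'⟩ := exists_adj_of_pathKernel_ne_zero GB x hz4 hB4
        exact ⟨w', hH (hBle hw'), not_mem_support_piece hc hw'⟩
      · obtain ⟨w', hw'⟩ := exists_adj_of_pathKernel_ne_zero GB x hz3 hB3
        exact ⟨w', hH (hBle hw'), not_mem_support_piece hc hw'⟩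
    -- a free neighbour of `z` in the `B`-piece: its first step towards `S` in the `A`-piece
    have hzB' : z = p₃ ∨ z = p₄ ∨ ∃ w', (zdGraph 2).Adj z w' ∧ w' ∉ GB.support := by
      by_cases hz3 : z = p₃
      · exact Or.inl hz3
      by_cases hz4 : z = p₄
      · exact Or.inr (Or.inl hz4)
      refine Or.inr (Or.inr ?_)
      have hc' : ∀ w, w ∈ B → w ∈ A → w = z := fun w hwB hwA => hc w hwA hwB
      by_cases hz1 : z = p₁
      · have hz2 : z ≠ p₂ := hz1 ▸ h12
        obtain ⟨w', hw'⟩ := exists_adj_of_pathKernel_ne_zero GA x hz2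
          (by rwa [pathKernel_comm] at hA2)
        exact ⟨w', hH (hAle hw'), not_mem_support_piece hc' hw'⟩
      · obtain ⟨w', hw'⟩ := exists_adj_of_pathKernel_ne_zero GA x hz1
          (by rwa [pathKernel_comm] at hA1)
        exact ⟨w', hH (hAle hw'), not_mem_support_piece hc' hw'⟩
    -- the two brackets and monotonicity
    have hA : pathKernel GA x p₁ z * pathKernel GA x p₂ z ≤ pathKernel H x p₁ p₂ :=
      (bracket_le x h₃ GA (hAle.trans hH) hAfin p₁ p₂ z h12 hzA').trans (pathKernel_mono hAle x p₁ p₂)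
    have hB : pathKernel GB x z p₃ * pathKernel GB x z p₄ ≤ pathKernel H x p₃ p₄ := by
      rw [pathKernel_comm GB x z p₃, pathKernel_comm GB x z p₄]
      exact (bracket_le x h₃ GB (hBle.trans hH) hBfin p₃ p₄ z h34 hzB').trans (pathKernel_mono hBle x p₃ p₄)
    exact mul_le_mul' hA hB

/-- REGISTERED STUB `stub_interlacedOfGraphTP2` of line `corner-localisation` (skeleton v7, lead c2): the
decomposition `GraphTP2At x → ThreePoint(x) → InterlacedTP2At x` for every `0 ≤ x`, verbatim the registered
signature (`interlacedTP2At_of_graphTP2At`). [folklore] -/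
theorem stub_interlacedOfGraphTP2 : ∀ x : ℝ, 0 ≤ x → BoundaryTP2.GraphTP2At x →
    (∀ H : SimpleGraph (Site 2), H ≤ zdGraph 2 → H.support.Finite →
      ∀ w w' p q : Site 2, (zdGraph 2).Adj w w' → w' ∉ H.support → w ≠ p → w ≠ q → p ≠ q →
        BoundaryTP2.pathKernel H x w p * BoundaryTP2.pathKernel H x w q ≤ BoundaryTP2.pathKernel H x p q) →
    BoundaryTP2.InterlacedTP2At x :=
  fun _ hx h₁ h₃ => interlacedTP2At_of_graphTP2At hx h₁ h₃

end Summit.CriticalPhenomena.SAWScalingLimit.Theorems.LeftRightFKG.ThreePoint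

end
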